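import Summits.KontsevichZagierPeriods.Zeta5Search.Barrier.ConeGammaCuspSlopeChamber

/-!
# ζ(5) search — BARRIER: THE TOP FLIP-ORDER CHAMBERS COVER `ℝ⁸` — oriented weights for EVERY displacement

HONEST FRAMING (cell `pub-zeta5`): systematic search; no irrationality claim unless kernel-certified. MODEL objects
under Brown–Zudilin's (28)+(30) accounting ([BZ22] = arXiv:2210.03391; (28) observed, not proved); nothing here is a
statement about `ζ(5)`, any `γ` of record, the cone's supremum (C2 OPEN) or the VALUE / SIGN of the cusp slope or of
its weights at a named direction (DATA of the cell); S-E stays CONJECTURED; records in print UNMOVED. Prover P2 g30,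
item «THE JUNCTION VOTE IS A LOVÁSZ EXTENSION» (INBOX 2026-08-27), file (1); sequel of P2 g29's
`ConeGammaCuspSlopeChamber` (menu (a), the covering half).

P2 g29 proved that the cusp slope `σ = cuspSlope a T` is integer-linear on the CLOSED flip-order chamber of any
`δ₀`, with ORIENTED weights (`𝒥 ≥ 0` on `F`, `≤ 0` off `F`) when the 28 flip times of `δ₀` are pairwise distinct.
This file supplies the covering lemma: EVERY displacement `δ` is refined by such a generic `δ₀`.
* `phiForm_single_fst`, `phiForm_single_snd`, `phiForm_single_eq_zero` — the 28 forms on the coordinate vectors (a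
  form sees exactly the two indices of its pair); `exists_rate_sub_ne_zero` — for `k ≠ l` the rate difference
  `φ_k/h_k − φ_l/h_l` is a non-zero linear functional;
* `exists_forall_ne_zero_of_linear` — finitely many non-zero linear functionals on `ℝ⁸` have a common non-zero
  point (one-parameter avoidance); **`exists_rates_separated`** — some `v` has all 28 rates pairwise distinct;
* **`exists_generic_refines`** — for every `δ` there is `δ₀ = δ + ε·v` with pairwise distinct flip times such that
  every strict flip-time inequality of `δ` is one of `δ₀` (`δ` lies in the closed chamber of `δ₀`): THE TOP CHAMBERS
  COVER `ℝ⁸`;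
* **`cuspSlope_eq_intLinear_oriented`** — hence for EVERY `δ` (not only on generic chambers) there are
  `𝒥 ∈ ℤ²⁸`, `Σ𝒥 = 0`, `𝒥_k ≥ 0` (`k ∈ F`), `𝒥_k ≤ 0` (`k ∉ F`) with `σ(δ') = Σ_k 𝒥_k φ_k(δ')/h_k(a)` on a closed
  chamber containing `δ`, in particular at `δ` (`cuspSlope_eq_intLinear_oriented_self`).
DESK (DATA, `HOME/pub-zeta5-p2/g30/alg/modcensus.py` (C4)): listing the chambers is NOT a finite certificate in
practice — 5 000 random displacements at record/41 have 5 000 distinct member flip orders. NOT here: anything about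
`γ` of record, C2, S-E, `ζ(5)`; the weights at any named direction.
-/

noncomputable section

open Set MeasureTheory
open scoped Topology

namespace Summit.KontsevichZagierPeriods.Zeta5Search.Barrier.ConeGamma

/-! ### The forms on coordinate vectors -/

/-- A form does not vanish on the coordinate vector of its FIRST index (value `1`). -/
theorem phiForm_single_fst (k : Fin 28) : phiForm (Pi.single (fstIdx k) 1) k = 1 := by
  rw [phiForm_eq]
  have hne := fstIdx_ne_sndIdx k
  unfold pairForm
  by_cases h0 : fstIdx k = 0
  · rw [if_pos h0, h0, Pi.single_eq_same, Pi.single_eq_of_ne (fun h => hne (by rw [h0, ← h])), sub_zero]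
  · have hs0 : sndIdx k ≠ 0 := fun h => by
      have := fstIdx_lt_sndIdx k; rw [h] at this; exact absurd this (Fin.not_lt_zero _)
    rw [if_neg h0, if_neg hs0, Pi.single_eq_same, Pi.single_eq_of_ne (Ne.symm hne), add_zero]

/-- A form does not vanish on the coordinate vector of its SECOND index (value `±1`). -/
theorem phiForm_single_snd (k : Fin 28) :
    phiForm (Pi.single (sndIdx k) 1) k = if fstIdx k = 0 then -1 else 1 := by
  rw [phiForm_eq]
  have hne := fstIdx_ne_sndIdx k
  have hs0 : sndIdx k ≠ 0 := fun h => by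
    have := fstIdx_lt_sndIdx k; rw [h] at this; exact absurd this (Fin.not_lt_zero _)
  unfold pairForm
  by_cases h0 : fstIdx k = 0
  · rw [if_pos h0, if_pos h0, Pi.single_eq_same, Pi.single_eq_of_ne hs0.symm]
    ring
  · rw [if_neg h0, if_neg hs0, if_neg h0, Pi.single_eq_same, Pi.single_eq_of_ne hne, zero_add]

/-- A form vanishes on the coordinate vector of an index OUTSIDE its pair. -/
theorem phiForm_single_eq_zero {k : Fin 28} {p : Fin 8} (h1 : p ≠ fstIdx k) (h2 : p ≠ sndIdx k) :
    phiForm (Pi.single p 1) k = 0 := by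
  rw [phiForm_eq]
  unfold pairForm
  by_cases h0 : fstIdx k = 0
  · rw [if_pos h0, Pi.single_eq_of_ne (by rw [← h0]; exact h1.symm), Pi.single_eq_of_ne h2.symm, sub_zero]
  · by_cases hs0 : sndIdx k = 0
    · rw [if_neg h0, if_pos hs0, Pi.single_eq_of_ne (by rw [← hs0]; exact h2.symm),
        Pi.single_eq_of_ne h1.symm, sub_zero]
    · rw [if_neg h0, if_neg hs0, Pi.single_eq_of_ne h1.symm, Pi.single_eq_of_ne h2.symm, add_zero]

/-- Distinct forms have distinct pairs: some index of the pair of `k` lies outside the pair of `l`. -/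
theorem exists_idx_not_mem_pair : ∀ k l : Fin 28, k ≠ l →
    (fstIdx k ≠ fstIdx l ∧ fstIdx k ≠ sndIdx l) ∨ (sndIdx k ≠ fstIdx l ∧ sndIdx k ≠ sndIdx l) := by
  decide

/-- **The rate difference of two distinct forms is a non-zero functional**: for `k ≠ l` (all forms of `a`
positive) some coordinate vector has `φ_k/h_k ≠ φ_l/h_l`. -/
theorem exists_rate_sub_ne_zero {a : Dir} (hpos : ∀ k, 0 < h28 a k) {k l : Fin 28} (hkl : k ≠ l) :
    ∃ v : Fin 8 → ℝ, phiForm v k / h28 a k - phiForm v l / h28 a l ≠ 0 := by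
  rcases exists_idx_not_mem_pair k l hkl with ⟨h1, h2⟩ | ⟨h1, h2⟩
  · refine ⟨Pi.single (fstIdx k) 1, ?_⟩
    rw [phiForm_single_fst, phiForm_single_eq_zero h1 h2, zero_div, sub_zero]
    exact div_ne_zero one_ne_zero (hpos k).ne'
  · refine ⟨Pi.single (sndIdx k) 1, ?_⟩
    rw [phiForm_single_snd, phiForm_single_eq_zero h1 h2, zero_div, sub_zero]
    refine div_ne_zero ?_ (hpos k).ne'
    split_ifs <;> norm_num

/-! ### Finitely many non-zero linear functionals have a common non-zero point -/

/-- **One-parameter avoidance.** A finite family of additive, homogeneous real functionals on `ℝ⁸`, each non-zero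
somewhere, has a point where ALL of them are non-zero (induction: move the good point along a witness direction and
avoid finitely many parameters). -/
theorem exists_forall_ne_zero_of_linear {ι : Type*} (s : Finset ι) (g : ι → (Fin 8 → ℝ) → ℝ)
    (hadd : ∀ i v w, g i (v + w) = g i v + g i w) (hsmul : ∀ i (t : ℝ) v, g i (t • v) = t * g i v)
    (hne : ∀ i ∈ s, ∃ v, g i v ≠ 0) : ∃ v, ∀ i ∈ s, g i v ≠ 0 := by
  classical
  induction s using Finset.induction_on with
  | empty => exact ⟨0, fun i hi => absurd hi (Finset.notMem_empty _)⟩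
  | insert j s hj ih =>
    obtain ⟨v, hv⟩ := ih fun i hi => hne i (Finset.mem_insert_of_mem hi)
    obtain ⟨y, hy⟩ := hne j (Finset.mem_insert_self _ _)
    -- the finitely many bad parameters
    let bad : Finset ℝ := insert (-(g j v) / g j y) (s.image fun i => -(g i v) / g i y)
    obtain ⟨t, ht⟩ := Infinite.exists_notMem_finset bad
    refine ⟨v + t • y, fun i hi => ?_⟩
    rw [hadd, hsmul]
    rcases Finset.mem_insert.mp hi with rfl | hi
    · intro h
      apply ht
      have : t = -(g i v) / g i y := by field_simp; linarith
      rw [this]; exact Finset.mem_insert_self _ _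
    · intro h
      by_cases hgy : g i y = 0
      · rw [hgy, mul_zero, add_zero] at h; exact hv i hi h
      · apply ht
        have : t = -(g i v) / g i y := by field_simp; linarith
        rw [this]; exact Finset.mem_insert_of_mem (Finset.mem_image.mpr ⟨i, hi, rfl⟩)

/-- **A displacement with all 28 rates pairwise distinct exists** (all forms of `a` positive): the 378 coincidence
hyperplanes `φ_k/h_k = φ_l/h_l` do not cover `ℝ⁸`. -/
theorem exists_rates_separated {a : Dir} (hpos : ∀ k, 0 < h28 a k) :
    ∃ v : Fin 8 → ℝ, ∀ k l : Fin 28, k ≠ l → phiForm v k / h28 a k ≠ phiForm v l / h28 a l := by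
  classical
  let P : Finset (Fin 28 × Fin 28) := Finset.univ.filter fun kl => kl.1 ≠ kl.2
  obtain ⟨v, hv⟩ := exists_forall_ne_zero_of_linear P
    (fun kl v => phiForm v kl.1 / h28 a kl.1 - phiForm v kl.2 / h28 a kl.2)
    (fun kl v w => by simp only [phiForm_add]; ring) (fun kl t v => by simp only [phiForm_smul]; ring)
    (fun kl hkl => exists_rate_sub_ne_zero hpos (Finset.mem_filter.mp hkl).2)
  exact ⟨v, fun k l hkl => sub_ne_zero.mp (hv (k, l) (Finset.mem_filter.mpr ⟨Finset.mem_univ _, hkl⟩))⟩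

/-! ### Every displacement is refined by a generic one -/

/-- **THE TOP CHAMBERS COVER `ℝ⁸`.** For all 28 forms of `a` positive and every displacement `δ` there is a
displacement `δ₀` whose 28 flip times `φ_k(δ₀)/h_k(a)` are PAIRWISE DISTINCT and which refines `δ`: every strict
inequality `φ_k(δ)/h_k < φ_l(δ)/h_l` also holds for `δ₀` — `δ` lies in the closed flip-order chamber of the generic
`δ₀` (`δ₀ = δ + ε·v` for a separated `v` and `ε` below half the smallest non-zero gap of `δ`). -/
theorem exists_generic_refines {a : Dir} (hpos : ∀ k, 0 < h28 a k) (δ : Fin 8 → ℝ) :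
    ∃ δ₀ : Fin 8 → ℝ, (∀ k l : Fin 28, k ≠ l → phiForm δ₀ k / h28 a k ≠ phiForm δ₀ l / h28 a l) ∧
      ∀ k l : Fin 28, phiForm δ k / h28 a k < phiForm δ l / h28 a l →
        phiForm δ₀ k / h28 a k < phiForm δ₀ l / h28 a l := by
  classical
  obtain ⟨v, hv⟩ := exists_rates_separated hpos
  -- shorthand for the rates
  obtain ⟨r, hr⟩ : ∃ r : (Fin 8 → ℝ) → Fin 28 → ℝ, ∀ θ k, r θ k = phiForm θ k / h28 a k := ⟨_, fun _ _ => rfl⟩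
  have hr_add : ∀ k (ε : ℝ), r (δ + ε • v) k = r δ k + ε * r v k := fun k ε => by
    rw [hr, hr, hr, phiForm_add, phiForm_smul]; ring
  -- the largest rate difference of `v` and the smallest non-zero gap of `δ`
  let B : ℝ := (Finset.univ : Finset (Fin 28 × Fin 28)).sup' (by simp) fun kl => |r v kl.1 - r v kl.2|
  have hB : ∀ k l, |r v k - r v l| ≤ B := fun k l =>
    Finset.le_sup' (fun kl : Fin 28 × Fin 28 => |r v kl.1 - r v kl.2|) (Finset.mem_univ (k, l))
  have hB0 : 0 ≤ B := (abs_nonneg _).trans (hB 0 0)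
  let A : Finset (Fin 28 × Fin 28) := Finset.univ.filter fun kl => r δ kl.1 ≠ r δ kl.2
  by_cases hA : A.Nonempty
  · let m : ℝ := A.inf' hA fun kl => |r δ kl.1 - r δ kl.2|
    have hm : ∀ k l, r δ k ≠ r δ l → m ≤ |r δ k - r δ l| := fun k l h =>
      Finset.inf'_le (fun kl : Fin 28 × Fin 28 => |r δ kl.1 - r δ kl.2|)
        (Finset.mem_filter.mpr ⟨Finset.mem_univ (k, l), h⟩)
    have hm0 : 0 < m := by
      obtain ⟨kl, hkl, hmin⟩ := Finset.exists_mem_eq_inf' hA fun kl => |r δ kl.1 - r δ kl.2|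
      rw [show m = |r δ kl.1 - r δ kl.2| from hmin]
      exact abs_pos.mpr (sub_ne_zero.mpr (Finset.mem_filter.mp hkl).2)
    set ε : ℝ := m / (2 * (B + 1)) with hε
    have hε0 : 0 < ε := div_pos hm0 (by linarith)
    have hεB : ε * B < m / 2 := by
      have h1 : ε * B ≤ ε * (B + 1) - ε := by nlinarith
      have h2 : ε * (B + 1) = m / 2 := by rw [hε]; field_simp
      linarith
    have hsmall : ∀ k l, |ε * (r v k - r v l)| < m / 2 := fun k l => by
      rw [abs_mul, abs_of_pos hε0]
      exact (mul_le_mul_of_nonneg_left (hB k l) hε0.le).trans_lt hεB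
    refine ⟨δ + ε • v, fun k l hkl => ?_, fun k l hlt => ?_⟩
    · rw [← hr, ← hr, hr_add, hr_add]
      intro h
      by_cases hδ : r δ k = r δ l
      · have : ε * (r v k - r v l) = 0 := by linarith
        rcases mul_eq_zero.mp this with h' | h'
        · exact absurd h' hε0.ne'
        · exact hv k l hkl (by rw [← hr, ← hr]; linarith)
      · have h1 := hm k l hδ
        have e : |r δ k - r δ l| = |ε * (r v k - r v l)| := by
          rw [show r δ k - r δ l = -(ε * (r v k - r v l)) by linarith, abs_neg]
        linarith [hsmall k l]
    · rw [← hr, ← hr] at hlt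
      rw [← hr, ← hr, hr_add, hr_add]
      have h1 := hm k l hlt.ne
      rw [abs_of_nonpos (by linarith : r δ k - r δ l ≤ 0)] at h1
      have h2 := (abs_lt.mp (hsmall k l)).2
      have h4 : ε * (r v k - r v l) = ε * r v k - ε * r v l := by ring
      linarith
  · -- all rates of `δ` coincide: take `δ + v`
    have hall : ∀ k l, r δ k = r δ l := fun k l => by
      by_contra h
      exact hA ⟨(k, l), Finset.mem_filter.mpr ⟨Finset.mem_univ _, h⟩⟩
    refine ⟨δ + (1 : ℝ) • v, fun k l hkl => ?_, fun k l hlt => ?_⟩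
    · rw [← hr, ← hr, hr_add, hr_add, hall k l, one_mul, one_mul]
      intro h
      exact hv k l hkl (by rw [← hr, ← hr]; linarith)
    · rw [← hr, ← hr, hall k l] at hlt
      exact absurd hlt (lt_irrefl _)

/-- **ORIENTED WEIGHTS FOR EVERY DISPLACEMENT.** For all 28 forms of `a` positive, `T > 0` a period and ANY
displacement `δ`: there are a generic `δ₀` refining `δ` and integers `𝒥_k` with `Σ_k 𝒥_k = 0`, `𝒥_k ≥ 0` for `k ∈ F`,
`𝒥_k ≤ 0` for `k ∉ F`, such that `cuspSlope a T δ' = Σ_k 𝒥_k · φ_k(δ')/h_k(a)` for every `δ'` refined by `δ₀` — in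
particular at `δ' = δ`. (P2 g29's `cuspSlope_eq_intLinear_of_generic` on the chamber of `exists_generic_refines`.) -/
theorem cuspSlope_eq_intLinear_oriented {a : Dir} (hpos : ∀ k, 0 < h28 a k) {T : ℝ} (hT : 0 < T)
    (hper : ∀ k : Fin 28, ∃ z : ℤ, T * h28 a k = z) (δ : Fin 8 → ℝ) :
    ∃ δ₀ : Fin 8 → ℝ, (∀ k l : Fin 28, k ≠ l → phiForm δ₀ k / h28 a k ≠ phiForm δ₀ l / h28 a l) ∧
      (∀ k l : Fin 28, phiForm δ k / h28 a k < phiForm δ l / h28 a l →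
        phiForm δ₀ k / h28 a k < phiForm δ₀ l / h28 a l) ∧
      ∃ 𝒥 : Fin 28 → ℤ, ∑ k, 𝒥 k = 0 ∧ (∀ k, k ∈ FIdx → 0 ≤ 𝒥 k) ∧ (∀ k, k ∉ FIdx → 𝒥 k ≤ 0) ∧
        (∀ δ' : Fin 8 → ℝ, (∀ k l : Fin 28, phiForm δ' k / h28 a k < phiForm δ' l / h28 a l →
            phiForm δ₀ k / h28 a k < phiForm δ₀ l / h28 a l) →
          cuspSlope a T δ' = ∑ k, (𝒥 k : ℝ) * (phiForm δ' k / h28 a k)) ∧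
        cuspSlope a T δ = ∑ k, (𝒥 k : ℝ) * (phiForm δ k / h28 a k) := by
  obtain ⟨δ₀, hgen, href⟩ := exists_generic_refines hpos δ
  obtain ⟨𝒥, h0, hF, hFc, hlin⟩ := cuspSlope_eq_intLinear_of_generic hpos hT hper hgen
  exact ⟨δ₀, hgen, href, 𝒥, h0, hF, hFc, hlin, hlin δ href⟩

/-- The instance at `δ`: **for EVERY displacement the cusp slope is an ORIENTED integer combination of the rates**,
`σ(δ) = Σ_k 𝒥_k φ_k(δ)/h_k(a)`, `Σ𝒥 = 0`, `𝒥 ≥ 0` on `F`, `𝒥 ≤ 0` off `F`. -/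
theorem cuspSlope_eq_intLinear_oriented_self {a : Dir} (hpos : ∀ k, 0 < h28 a k) {T : ℝ} (hT : 0 < T)
    (hper : ∀ k : Fin 28, ∃ z : ℤ, T * h28 a k = z) (δ : Fin 8 → ℝ) :
    ∃ 𝒥 : Fin 28 → ℤ, ∑ k, 𝒥 k = 0 ∧ (∀ k, k ∈ FIdx → 0 ≤ 𝒥 k) ∧ (∀ k, k ∉ FIdx → 𝒥 k ≤ 0) ∧
      cuspSlope a T δ = ∑ k, (𝒥 k : ℝ) * (phiForm δ k / h28 a k) := by
  obtain ⟨-, -, -, 𝒥, h0, hF, hFc, -, hδ⟩ := cuspSlope_eq_intLinear_oriented hpos hT hper δ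
  exact ⟨𝒥, h0, hF, hFc, hδ⟩

end Summit.KontsevichZagierPeriods.Zeta5Search.Barrier.ConeGamma

end
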